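/-
Copyright (c) 2026 the pub-hodgecm-mathlib formalisation cell (harness21).  Prover seat hodgecm-mathlib-K2E4-p14 (g10), Track B «K2-LIT», h413 = `stmt-HodgeConjecture-24833`,
route of record `HCCMUnconditional`; RUNG 1 of the 5Res ladder (R90-TF LEAD ∕ dealer K2E1-plan (g7) LEAD #18 (3) ∕ #19), input (SD-∞) of the FINAL ★ p861721.
-/
import Summits.HodgeConjecture.HodgeConjecture.Theorems.K2E1SelfDualChiFamiliesFiniteCMTwo   -- ★ p861076 (K2E1-p13): `chi_fixedSq_eq_one_of_selfDual`, `exists_central_torus_cm`; brings ★ C8 `exists_torus_mul_sq_fixed`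
import Summits.HodgeConjecture.HodgeConjecture.Theorems.K2E1ChiHeckeArchScalarU2             -- ★ 12d-C (K2-defs1): `exists_mem_comap_borel_mul_mem_comap_K_arch` (arch Iwasawa, comap spelling)
import Literature.NumberTheory.Automorphic.IdeleClassBaseChangeInfinite                      -- ★ `eq_infiniteIdeles_of_snd_eq_one`
import HarnessLib

/-!
# `K2E1ChiSectionArchConstantSelfDualCMTwo` — (SD-∞): THE SECTIONS OF A **SELF-DUAL** BLOCK AT THE MAXIMAL LEVEL ARE ARCHIMEDEAN-CONSTANT,
# `φ(ι_∞ a) = φ(1)` for every `φ ∈ V(χ, K_∞·K_max,f, 1)`, `χʷ = χ` — the `hVinf` binder of the self-dual RUNG-1 package, with ONLY self-duality left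

Cell `pub/hodgecm-mathlib`, crux H413 = `stmt-HodgeConjecture-24833`.  THEOREMS ONLY (no `def`, no `instance`, no notation, no named-fact hypothesis, no `sorry`; default heartbeats);
lane `--supports stmt-HodgeConjecture-24833 --as helper` (count-neutral).  Closes no socket.  Frame: `G = U(1,1)_{L∕L⁺} = quasiSplit L⁺ L c 2`, `c` = complex conjugation of the CM
field `L`, `K = K_∞·GL₂(𝒪̂_L) ∩ G(𝔸) = comap adelicVal (standardMaximalCompactGL 2 L)`, `ι_∞ = archToAdelic`.

WHY (RUNG 1).  The self-dual per-block package of K2E4-p23 (`selfDual_block_package`, the `hSD` binder of ★ p861721 `residual_invariants_finiteDimensional_maximalLevel_cm_final`) needs, for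
EVERY self-dual ray-trivial `χ` with `V(χ, K, 1) ≠ ⊥`, the M1 datum `hVinf : ∀ φ ∈ V(χ, K, 1), ∀ a, φ(ι_∞ a) = φ(1)`.  ★ `hVinf_maximalLevel` (p860700) derives it from «`χ_∞ = 1`»
(`hχ : χ(β₀₀) = 1` for every archimedean Borel `β`), which is an INPUT there.  This file proves `hχ` — hence `hVinf` — from SELF-DUALITY and one non-zero section, so that the
FINAL's ED.2 pays `hVinf` by name for every `b ∈ S₂`.

THE MATHEMATICS ([MoeglinWaldspurger1995, I.2.17, V.3.13]; [BorelJacquet1979, §4.1]; [WeilBNT1967, Ch. IV §4]).  Let `β ∈ G_∞` with `ι_∞β ∈ B(𝔸)` and `d₀ = β₀₀ ∈ 𝕀_L`.  Its finite part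
is `1` (★ `map_snd_ofInfinite`), so `d₀ = ι_∞(a_∞)` (★ `eq_infiniteIdeles_of_snd_eq_one`); write `a_∞ = k·q·q` with `k k̄ = 1` and `q` totally positive real, `c • ι_∞q = ι_∞q` (★ C8
`exists_torus_mul_sq_fixed`).  SELF-DUALITY `χʷ = χ ⇔ χ(x)χ(c•x) = 1` kills the fixed square: `χ(ι_∞q · ι_∞q) = 1` (★ R1 `chi_fixedSq_eq_one_of_selfDual`, unitarity-free).  The unitary
scalar `k` is seen by the section: ★ R1 `exists_central_torus_cm` produces a CENTRAL diagonal torus element `z = ι_∞κ ∈ K ∩ B(𝔸)` with `z₀₀ = ι_∞k`, so for `φ ∈ V(χ, K, 1)`,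
`χ(ι_∞k)·φ(1) = φ(z·1) = φ(1·z) = φ(1)` (`χ`-section rule on the left, right-`K`-invariance on the right), i.e. `χ(ι_∞k) = 1` as soon as `φ(1) ≠ 0`.  Hence `χ(d₀) = 1`
(§1).  Finally arch Iwasawa `a = β κ` (★ `exists_mem_comap_borel_mul_mem_comap_K_arch`) gives `φ(ι_∞a) = φ(ι_∞β · ι_∞κ) = φ(ι_∞β) = χ(β₀₀)·φ(1)`, which is `φ(1)` in both cases
`φ(1) = 0` and `φ(1) ≠ 0` (§2).
* §1 `chi_firstEntryUnit_archToAdelic_eq_one_of_selfDual_cm` — `χʷ = χ`, `φ ∈ V(χ, K, 1)`, `φ(1) ≠ 0` ⟹ `χ(β₀₀) = 1` for every archimedean Borel `β` (the `hχ` of ★ p860700).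
* §2 HEAD **`hVinf_maximalLevel_of_selfDual_cm`** — `χʷ = χ ⟹ ∀ φ ∈ V(χ, K, 1), ∀ a, φ(ι_∞ a) = φ(1)` (K2E4-p23's `hVinf` binder token-for-token, only `hsd` left).
HONEST LABEL: HC_CM is proved only modulo the 7 printed citations (2 remaining named inputs: hLiu418 = `stmt-HodgeConjecture-24832`, h413 = `stmt-HodgeConjecture-24833`) until rung 0
closes; this file asserts no named fact and closes no socket; count-neutral; unconditional.

## Tree search (all ★, nothing restated)
`K2E1SelfDualChiFamiliesFiniteCMTwo.chi_fixedSq_eq_one_of_selfDual` ∕ `exists_central_torus_cm` (p861076); `K2E1SelfDualHeckeCharactersFiniteCMTwo.exists_torus_mul_sq_fixed` (C8);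
`K2E1ChiHeckeArchScalarU2.exists_mem_comap_borel_mul_mem_comap_K_arch` (12d-C); `K2E1ChiSectionSpaceU2Defs.isChiSection_of_mem` ∕ `apply_mul_of_mem` ∕ `firstEntryUnit_eq_diagUnit_zero`;
`K2E1CharacterEisensteinU2Defs.IsChiSection.borel_mul`; `UnitaryGroup.map_snd_ofInfinite`, `UnitaryGroup.complexConj_smul_infinitePlace`, `IsCMField.complexConj_ne_one`;
`Literature.NumberTheory.Automorphic.eq_infiniteIdeles_of_snd_eq_one`.

## References
* [MoeglinWaldspurger1995] C. Mœglin, J.-L. Waldspurger, *Spectral Decomposition and Eisenstein Series* (1995): I.2.17 (sections at a level), V.3.13 (residual data `χ = χʷ`).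
* [BorelJacquet1979] A. Borel, H. Jacquet, *Automorphic forms and automorphic representations*, PSPM 33.1 (1979): §4.1 (`G(𝔸) = G_∞·G(𝔸_f)`, `G_∞ = B_∞K_∞`, the centre).
* [WeilBNT1967] A. Weil, *Basic Number Theory* (1967): Ch. IV §4, Thm. 6 (`𝕀_∞ = (S¹)^{r₂}·(ℝ_{>0})^{r₂}` for a totally complex field).
-/

set_option autoImplicit false
set_option linter.dupNamespace false  -- the mandated namespace repeats the summit's segment (`HodgeConjecture.HodgeConjecture`)

noncomputable section

open NumberField NumberField.mixedEmbedding NumberField.InfinitePlace IsDedekindDomain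
open scoped NNReal MatrixGroups
open Literature.NumberTheory Literature.NumberTheory.Automorphic Literature.NumberTheory.Automorphic.UnitaryGroup Literature.NumberTheory.GaloisRepresentations AdelicGroupData
open Summit.HodgeConjecture.HodgeConjecture.Cruxes.H413.K2E1BorelEisensteinU
open Summit.HodgeConjecture.HodgeConjecture.Cruxes.H413.K2E1CharacterEisensteinU2Defs
open Summit.HodgeConjecture.HodgeConjecture.Cruxes.H413.K2E1ChiSectionSpaceU2Defs
open Summit.HodgeConjecture.HodgeConjecture.Cruxes.H413.K2E1ChiHeckeArchScalarU2 (exists_mem_comap_borel_mul_mem_comap_K_arch)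
open Summit.HodgeConjecture.HodgeConjecture.Cruxes.H413.K2E1SelfDualHeckeCharactersFiniteCMTwo (exists_torus_mul_sq_fixed)
open Summit.HodgeConjecture.HodgeConjecture.Cruxes.H413.K2E1SelfDualChiFamiliesFiniteCMTwo (chi_fixedSq_eq_one_of_selfDual exists_central_torus_cm)

namespace Summit.HodgeConjecture.HodgeConjecture.Cruxes.H413.K2E1ChiSectionArchConstantSelfDualCMTwo

variable (L : Type) [Field L] [NumberField L] [IsCMField L]

/-! ## §1 `χ(β₀₀) = 1` for every archimedean Borel `β`, from self-duality and one section with `φ(1) ≠ 0` -/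

/-- **«`χ_∞ = 1`» FOR A SELF-DUAL BLOCK WITH A SECTION**: if `χʷ = χ`, `φ ∈ V(χ, K, 1)` (`K = K_∞·K_max,f`) and `φ(1) ≠ 0`, then `χ(β₀₀) = 1` for every `β ∈ G_∞` with `ι_∞β ∈ B(𝔸)` — the
hypothesis `hχ` of ★ `hVinf_maximalLevel` ∕ `apply_eq_apply_finPart_cm`.  (`β₀₀ = ι_∞(k·q·q)`; the fixed square dies by self-duality, the unitary scalar `k` by `φ(z·1) = φ(1·z)` for the central torus
element `z = ι_∞κ ∈ K`, `z₀₀ = ι_∞k`.) [cite: MoeglinWaldspurger1995, I.2.17, V.3.13] [cite: BorelJacquet1979, §4.1] -/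
theorem chi_firstEntryUnit_archToAdelic_eq_one_of_selfDual_cm {χ : HeckeCharacter L} (hsd : reflectChar (IsCMField.complexConj L) χ = χ)
    {φ : (quasiSplit (↥(maximalRealSubfield L)) L (IsCMField.complexConj L) 2).Adelic → ℂ}
    (hφ : φ ∈ chiSectionSpace χ ((standardMaximalCompactGL 2 L).comap (adelicVal (↥(maximalRealSubfield L)) L (IsCMField.complexConj L) 2 ((StdForm.antidiagonal 2).over L)) : Subgroup (quasiSplit (↥(maximalRealSubfield L)) L (IsCMField.complexConj L) 2).Adelic) 1)
    (h1 : φ 1 ≠ 0) (a : arch (↥(maximalRealSubfield L)) L (IsCMField.complexConj L) 2 ((StdForm.antidiagonal 2).over L))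
    (hb : archToAdelic (↥(maximalRealSubfield L)) L (IsCMField.complexConj L) 2 ((StdForm.antidiagonal 2).over L) a ∈ borelAdelic (↥(maximalRealSubfield L)) L (IsCMField.complexConj L) 2) :
    χ (firstEntryUnit hb) = 1 := by
  -- (A) the unitary archimedean scalars: `χ(ι_∞ k) = 1` for `k k̄ = 1`, seen by the section at the central torus element `z = ι_∞ κ ∈ K`
  have hk1 : ∀ k : ↥(relNormOneInfUnits (↥(maximalRealSubfield L)) L), χ (infiniteIdeles L (k : (InfiniteAdeleRing L)ˣ)) = 1 := fun k => by
    obtain ⟨z, -, ⟨κ, hκz, hκK⟩, hd⟩ := exists_central_torus_cm L k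
    have hzK : ((z : borelAdelic (↥(maximalRealSubfield L)) L (IsCMField.complexConj L) 2) : (quasiSplit (↥(maximalRealSubfield L)) L (IsCMField.complexConj L) 2).Adelic) ∈
        (((standardMaximalCompactGL 2 L).comap (adelicVal (↥(maximalRealSubfield L)) L (IsCMField.complexConj L) 2 ((StdForm.antidiagonal 2).over L)) : Subgroup (quasiSplit (↥(maximalRealSubfield L)) L (IsCMField.complexConj L) 2).Adelic)) := by
      rw [← hκz]; exact Subgroup.mem_comap.2 hκK
    have e1 := (isChiSection_of_mem hφ).borel_mul (z : borelAdelic (↥(maximalRealSubfield L)) L (IsCMField.complexConj L) 2).2 1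
    have e2 := apply_mul_of_mem hφ 1 ⟨_, hzK⟩
    rw [mul_one] at e1
    rw [Pi.one_apply, one_mul, one_mul] at e2
    have e3 : ((χ (firstEntryUnit (z : borelAdelic (↥(maximalRealSubfield L)) L (IsCMField.complexConj L) 2).2) : ℂˣ) : ℂ) = 1 :=
      (mul_eq_right₀ h1).1 (e1.symm.trans e2)
    rw [firstEntryUnit_eq_diagUnit_zero, hd] at e3
    exact Units.val_eq_one.1 e3
  -- (B) `d₀ = β₀₀` has finite part `1`, so it is an infinite idele `ι_∞ a_∞`
  have hsnd : ((firstEntryUnit hb : ideleGroup L) : AdeleRing (𝓞 L) L).2 = 1 := by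
    have h := congrFun (congrFun (map_snd_ofInfinite L 2 (a : GL (Fin 2) (mixedSpace L))) 0) 0
    rw [Matrix.map_apply, Matrix.one_apply_eq] at h
    exact h
  obtain ⟨ainf, hainf⟩ := eq_infiniteIdeles_of_snd_eq_one L hsnd
  -- (C) `a_∞ = k·q·q`: the fixed square dies by self-duality, the unitary scalar by (A)
  obtain ⟨k, hk, q, hcq, hkq⟩ := exists_torus_mul_sq_fixed L ainf
  rw [hainf, hkq, mul_assoc, map_mul (infiniteIdeles L), map_mul χ, map_mul (infiniteIdeles L), chi_fixedSq_eq_one_of_selfDual hsd hcq, mul_one]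
  exact hk1 ⟨k, hk⟩

/-! ## §2 HEAD: the sections of a self-dual block are archimedean-constant -/

/-- **(SD-∞) `φ(ι_∞ a) = φ(1)` FOR EVERY SECTION OF A SELF-DUAL BLOCK AT THE MAXIMAL LEVEL** — the `hVinf` binder of the self-dual RUNG-1 package (K2E4-p23's `selfDual_block_package`), with only
`χʷ = χ` left: arch Iwasawa `a = βκ` (★ 12d-C) gives `φ(ι_∞a) = φ(ι_∞β) = χ(β₀₀)·φ(1)`, and `χ(β₀₀) = 1` by §1 when `φ(1) ≠ 0` (trivially `= φ(1)` when `φ(1) = 0`).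
[cite: MoeglinWaldspurger1995, I.2.17, V.3.13] [cite: BorelJacquet1979, §4.1] -/
theorem hVinf_maximalLevel_of_selfDual_cm {χ : HeckeCharacter L} (hsd : reflectChar (IsCMField.complexConj L) χ = χ) :
    ∀ φ ∈ chiSectionSpace χ ((standardMaximalCompactGL 2 L).comap (adelicVal (↥(maximalRealSubfield L)) L (IsCMField.complexConj L) 2 ((StdForm.antidiagonal 2).over L)) : Subgroup (quasiSplit (↥(maximalRealSubfield L)) L (IsCMField.complexConj L) 2).Adelic) 1,
      ∀ a : arch (↥(maximalRealSubfield L)) L (IsCMField.complexConj L) 2 ((StdForm.antidiagonal 2).over L), φ (archToAdelic (↥(maximalRealSubfield L)) L (IsCMField.complexConj L) 2 _ a) = φ 1 := by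
  intro φ hφ a
  obtain ⟨β, hβ, κ, hκ, rfl⟩ := exists_mem_comap_borel_mul_mem_comap_K_arch (IsCMField.complexConj_ne_one L) (complexConj_smul_infinitePlace L) a
  have hβ' : archToAdelic (↥(maximalRealSubfield L)) L (IsCMField.complexConj L) 2 ((StdForm.antidiagonal 2).over L) β ∈ borelAdelic (↥(maximalRealSubfield L)) L (IsCMField.complexConj L) 2 :=
    Subgroup.mem_comap.1 hβ
  have hκK : archToAdelic (↥(maximalRealSubfield L)) L (IsCMField.complexConj L) 2 ((StdForm.antidiagonal 2).over L) κ ∈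
      (((standardMaximalCompactGL 2 L).comap (adelicVal (↥(maximalRealSubfield L)) L (IsCMField.complexConj L) 2 ((StdForm.antidiagonal 2).over L)) : Subgroup (quasiSplit (↥(maximalRealSubfield L)) L (IsCMField.complexConj L) 2).Adelic)) :=
    Subgroup.mem_comap.1 hκ
  have e2 := apply_mul_of_mem hφ (archToAdelic (↥(maximalRealSubfield L)) L (IsCMField.complexConj L) 2 ((StdForm.antidiagonal 2).over L) β) ⟨_, hκK⟩
  rw [Pi.one_apply, one_mul] at e2
  have e1 := (isChiSection_of_mem hφ).borel_mul hβ' 1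
  rw [mul_one] at e1
  rw [map_mul, e2, e1]
  by_cases h1 : φ 1 = 0
  · rw [h1, mul_zero]
  · rw [chi_firstEntryUnit_archToAdelic_eq_one_of_selfDual_cm L hsd hφ h1 β hβ', Units.val_one, one_mul]

end Summit.HodgeConjecture.HodgeConjecture.Cruxes.H413.K2E1ChiSectionArchConstantSelfDualCMTwo

end
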